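import Literature.NumberTheory.EllipticCurves.BhargavaShankarUpperSieveAssemblyProofs
import Literature.NumberTheory.EllipticCurves.BSDWave0Proofs
import HarnessLib

/-!
# Bhargava–Shankar, Thm 1.1 in `limsup` form (`heightAverageLE_card_selmerTwo`): the proved frontier

`Proofs` companion of `BSDSelmer.lean` (theorems only: no definitions, no named facts). Source:
M. Bhargava, A. Shankar, *Binary quartic forms having bounded invariants, and the boundedness of
the average rank of elliptic curves*, Ann. of Math. (2) 181 (2015) 191–242 = arXiv:1006.1002
(`BhargavaShankarAnnals2015`); held text = v2 (§5.4, display (31), Thm 5.14), published text = v3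
(§2.5 Thm 2.12, §2.7 proof of Thm 2.21, §3.2–3.4, proof of Thm 3.19).

The named fact `Literature.NumberTheory.EllipticCurves.heightAverageLE_card_selmerTwo` (bsd.S26,
Thm 1.1 in `limsup` form: for every `ε > 0` the average of `#Sel^(2)(E_{A,B}/ℚ)` over the curves of
naive height `< X` is eventually `≤ 3 + ε`) is the `limsup` half of Theorem 1.1, and by the printed
argument (§5.4 of v2 = proof of Thm 3.19 of v3) it needs only the **upper** half (U31) of
eq. (31): `Σ_{H(E_{A,B}) < X} #{PGL₂(ℚ)-classes of locally soluble irreducible quartics with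
invariants 2⁴I(E), 2⁶J(E)} ≤ (2 c_F + ε) X^{5/6}` eventually — the tree's
`heightAverageLE_card_selmerTwo_of_sum_irredClassCount_le` (with Thm 5.6 =
`bhargavaShankar_card_selmerTwo_eq_holds`, Prop. 5.8 =
`bhargavaShankar_sum_card_selmerTwo_twoTorsion_le_holds`, Lemma 5.15 =
`card_heightFamilyBelow_asymptotic_holds`). The tree reduces (U31) to exactly two inputs, both
written out in binders (`BinaryQuartic.sum_irredClassCount_le_of_upperCongruenceCount`):

* **(D)** the upper congruence count (v3 Thm 2.12, upper bound, for `GL₂(ℤ)`-invariant weights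
  `Ψ` modulo `N` on the irreducible orbits of `V_ℤ^{(0)} ∪ V_ℤ^{(2+)} ∪ V_ℤ^{(1)}` of height `< X`:
  `Σ_O Ψ(f_O mod N) ≤ (ν(Ψ)·(8/27)ζ(2) + ε) X^{5/6}`, `(4 + 4 + 32)/135 = 8/27`);
* **(F)** the local integrals (v3 Prop. 3.6, Cor. 3.8/Prop. 3.9 = v2 Prop. 5.12 with weights
  `1/m_p`): `∫_{V_{ℤ_p}} φ_p = |2¹⁰/3³|_p · M_p(V,F)` for
  `φ_p = 1_{ℚ_p-soluble} 1_{(I,J) ∈ 2⁴F_p^{inv} × 2⁶F_p^{inv}} / m_p`.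

This file records the composite, so that the remaining obligations of the bsd.S26 `limsup` fact are
visible under its own name:

* `heightAverageLE_card_selmerTwo_of_upperCongruenceCount` — **(D) ∧ (F) ⇒ Thm 1.1 (`limsup`)**;
* `heightAverageLE_card_selmerTwo_of_average_card_selmerTwo` — the `Tendsto` form of Thm 1.1
  (`average_card_selmerTwo`, the limit `= 3`, which needs in addition the lower half of eq. (31),
  i.e. the uniformity estimate v2 Prop. 5.13 = v3 Thm 2.13) trivially implies the `limsup` form
  (`HeightAverageLE.of_tendsto`).

Nothing here uses the uniformity estimate, [dodqf] or the Delone–Evertse bound: as for Cor. 1.2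
(`BinaryQuartic.averageRankLE_three_halves_of_upperCongruenceCount`), the `limsup` statement only
needs the averaging method with finitely many congruence conditions and the `p`-adic masses.

## References

* M. Bhargava, A. Shankar, Ann. of Math. (2) 181 (2015) 191–242 = arXiv:1006.1002; v2: Thm 1.1,
  §5.4 display (31), Props. 5.7–5.8, 5.12, Thm 5.6, Lemma 5.15; v3: Thm 2.12, §2.7 (proof of
  Thm 2.21, upper bound), Prop. 3.6, Cor. 3.8, Prop. 3.9, proof of Thm 3.19.
  [cite: BhargavaShankarAnnals2015, Thm 1.1; §5.4 eq. (31) (arXiv:1006.1002v2 numbering); Thm 2.12 and §2.7 (published numbering)]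
-/

noncomputable section

open scoped Classical Topology
open Filter Set MeasureTheory Finset

namespace Literature.NumberTheory.EllipticCurves

open BinaryQuartic

/-- **Bhargava–Shankar, Thm 1.1 in `limsup` form (`heightAverageLE_card_selmerTwo`: the average of
`#Sel^(2)(E/ℚ)` over the curves `E_{A,B}` of naive height `< X` is eventually `≤ 3 + ε`) from the
upper congruence count (D) and the local integrals (F)** — the printed route: (D) ∧ (F) ⇒ (U31)
(`BinaryQuartic.sum_irredClassCount_le_of_upperCongruenceCount`: the upper-bound sieve of the proof
of Thm 2.21 applied to `φ = ∏_p φ_p` as in the proof of Thm 3.19, `m = ∏_p m_p`, Lemma 5.16) and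
(U31) ⇒ Thm 1.1 in `limsup` form (`heightAverageLE_card_selmerTwo_of_sum_irredClassCount_le`:
Thm 5.6, Props. 5.7–5.8, Lemma 5.15). The hypotheses are copied verbatim from
`BinaryQuartic.sum_irredClassCount_le_of_upperCongruenceCount`.
[cite: BhargavaShankarAnnals2015, Thm 1.1 (via §5.4 eq. (31), arXiv:1006.1002v2 numbering, and Thm 2.12, §2.7, Prop. 3.9 of the published version)] -/
theorem heightAverageLE_card_selmerTwo_of_upperCongruenceCount
    (hD : ∀ (N : ℕ) [NeZero N] (Ψ : (Fin 5 → ZMod N) → ℝ), (∀ r, 0 ≤ Ψ r) → (∀ r, Ψ r ≤ 1) →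
      (∀ f g : BinaryQuartic ℤ, GL2ZEquiv f g →
        Ψ (fun j => ((g.coeffs j : ℤ) : ZMod N)) = Ψ (fun j => ((f.coeffs j : ℤ) : ZMod N))) →
      ∀ ε : ℝ, 0 < ε → ∀ᶠ X : ℝ in atTop,
        ∀ (T : Finset (Set (BinaryQuartic ℤ))) (ρ : Set (BinaryQuartic ℤ) → BinaryQuartic ℤ),
          (↑T ⊆ gl2zOrbit '' {f : BinaryQuartic ℤ |
              f ∈ fourRealRoots ∪ posDefinite ∪ twoRealRoots ∧ f.IsIrreducible ∧ f.height < X}) →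
          (∀ O ∈ T, ρ O ∈ O) →
          ∑ O ∈ T, Ψ (fun j => (((ρ O).coeffs j : ℤ) : ZMod N)) ≤
            ((∑ r : Fin 5 → ZMod N, Ψ r) / (N : ℝ) ^ 5 * (8 / 27 * (Real.pi ^ 2 / 6)) + ε) *
              X ^ (5 / 6 : ℝ))
    (hF : ∀ (p : ℕ) [Fact p.Prime],
      ∫ f : BinaryQuartic ℤ_[p],
          (if (f.map PadicInt.Coe.ringHom).IsSoluble ∧
              (∃ IJ ∈ invariantPairsAdic p, f.I = 2 ^ 4 * IJ.1 ∧ f.J = 2 ^ 6 * IJ.2)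
            then (1 : ℝ) / localWeight f else 0) =
        ((padicNorm p (2 ^ 10 / 3 ^ 3) : ℚ) : ℝ) * localMassV p) :
    heightAverageLE_card_selmerTwo :=
  heightAverageLE_card_selmerTwo_of_sum_irredClassCount_le
    (sum_irredClassCount_le_of_upperCongruenceCount hD hF)

/-- The `Tendsto` form of Thm 1.1 (`average_card_selmerTwo`: the average of `#Sel^(2)(E/ℚ)` over
the curves of naive height `< X` tends to `3`) implies its `limsup` form
(`heightAverageLE_card_selmerTwo`): a sequence tending to `3` is eventually `≤ 3 + ε`
(`HeightAverageLE.of_tendsto`). The converse direction is the content of the lower half of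
eq. (31) (uniformity estimate, v2 Prop. 5.13 = v3 Thm 2.13), not used anywhere on the `limsup`
route. [cite: BhargavaShankarAnnals2015, Thm 1.1] -/
theorem heightAverageLE_card_selmerTwo_of_average_card_selmerTwo (h : average_card_selmerTwo) :
    heightAverageLE_card_selmerTwo :=
  HeightAverageLE.of_tendsto h

end Literature.NumberTheory.EllipticCurves

end
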